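import Literature.Analysis.FluidPDE.FluidComputer.ThresholdLevelTableW
import HarnessLib

/-!
# Kernel run of the level-table checker over the gate-data box, chunks 12 … 15 (bp3 gen 13, layer 4: robustness variant)

HONEST FRAMING: low prior, high value-of-information experiment on Tao's machine paradigm; NOT a
claim that NS blows up.

Four kernel evaluations (`decide +kernel`; no `native_decide`, no extra axioms) of `runSteps`
with the interval gate data `GIw` (all couplings within relative `10⁻³`, `δ ∈ [0, 1.001 δ₀]`),
25 steps each, from `Bw12` to `Bw16`.
-/

namespace Literature.Analysis.FluidPDE.FluidComputer

namespace ThresholdLevelTable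

set_option maxHeartbeats 10000000 in
set_option maxRecDepth 200000 in
/-- Chunk 12 of the data-box table run (steps 300 … 324). [folklore] -/
theorem runW12 : runSteps 60 12 3 GIw RbIt Bw12 chunk12 4525524321594313 = some Bw13 := by
  decide +kernel

set_option maxHeartbeats 10000000 in
set_option maxRecDepth 200000 in
/-- Chunk 13 of the data-box table run (steps 325 … 349). [folklore] -/
theorem runW13 : runSteps 60 12 3 GIw RbIt Bw13 chunk13 5386115000203920 = some Bw14 := by
  decide +kernel

set_option maxHeartbeats 10000000 in
set_option maxRecDepth 200000 in
/-- Chunk 14 of the data-box table run (steps 350 … 374). [folklore] -/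
theorem runW14 : runSteps 60 12 3 GIw RbIt Bw14 chunk14 6410358830024270 = some Bw15 := by
  decide +kernel

set_option maxHeartbeats 10000000 in
set_option maxRecDepth 200000 in
/-- Chunk 15 of the data-box table run (steps 375 … 399). [folklore] -/
theorem runW15 : runSteps 60 12 3 GIw RbIt Bw15 chunk15 7629376708093743 = some Bw16 := by
  decide +kernel

end ThresholdLevelTable

end Literature.Analysis.FluidPDE.FluidComputer
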